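import Mathlib
import HarnessLib

/-!
# Zhang (2022) §8/§10: the partial-summation engine behind "`Σ|χ(n)|λ₀ⱼ(n)φ(n)⁻¹g(n) = (𝔞/L′²)∫g dx/x + …`"

Topic `Literature/NumberTheory/LFunctions/Zhang2022` (Landau–Siegel audit tree; verdict-neutral).
Y. Zhang, arXiv:2211.02515v1 (2022) [Zhang2022LandauSiegel], §8 p. 48 ("it follows by partial
integration that (8.11)") and §10 pp. 57–61 (the displays "the sum over `P^a ≤ dr < P^b` is equal to …
`= (…𝔞…)∫…dx/x + o(α)`") — **an unrefereed manuscript under adjudication; this file proves elementary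
real-analysis lemmas only and asserts nothing about its Theorems 1–2.** D-0069 campaign (seat sz-d34).
For weights `w(n)` with counting function `Σ_{1≤n<N} w(n) = c log N + O(K)` and a profile `F` with
`‖F‖ ≤ M`, `‖F(x) − F(y)‖ ≤ L(y − x)/x`: `norm_sum_weight_sub_log_sum_le` (summation by parts),
`norm_log_sum_sub_integral_le` (Riemann step), `norm_integral_ceil_sub_integral_le` (endpoints), and
`norm_sum_weight_sub_integral_le`:
`‖Σ_{⌈lo⌉≤n<⌈hi⌉} w(n)F(n) − c∫_{lo}^{hi}F(t)dt/t‖ ≤ K(2M + 2L log((hi+1)/lo)) + |c|(2L + 2M)/lo` —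
the index convention of the §10 typed sums (`Typed.Sec10C.lamAvg`); the tree's
`AbelLog.norm_sum_mul_sub_integral_le` (d16) is the floor-indexed `C¹` form. Mathlib only.
[cite: Zhang2022LandauSiegel, §8 (8.11) p. 48]
-/

noncomputable section

open Complex Real

namespace Literature.NumberTheory.LFunctions.Zhang2022.SumIntegralRule

section Engine

/-- Summation by parts on `[N₁, N₂)`: `Σ (A(n+1) − A(n))F(n) = A(N₂)F(N₂) − A(N₁)F(N₁) +
Σ A(n+1)(F(n) − F(n+1))`. [folklore] -/
private theorem sbp {A : ℕ → ℂ} {F : ℕ → ℂ} {N₁ N₂ : ℕ} (h : N₁ ≤ N₂) :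
    ∑ n ∈ Finset.Ico N₁ N₂, (A (n + 1) - A n) * F n =
      A N₂ * F N₂ - A N₁ * F N₁ + ∑ n ∈ Finset.Ico N₁ N₂, A (n + 1) * (F n - F (n + 1)) := by
  induction N₂, h using Nat.le_induction with
  | base => simp
  | succ N hN ih =>
    rw [Finset.sum_Ico_succ_top hN, Finset.sum_Ico_succ_top hN, ih]
    ring

/-- `1/n ≤ 2 log((n+1)/n)` for `n ≥ 1` (`log((n+1)/n) ≥ 1/(n+1) ≥ 1/(2n)`). [folklore] -/
private theorem inv_le_two_log_succ_div {n : ℕ} (hn : 1 ≤ n) :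
    (1 : ℝ) / n ≤ 2 * Real.log (((n : ℝ) + 1) / n) := by
  have hn0 : (0 : ℝ) < n := by exact_mod_cast hn
  have hn1 : (1 : ℝ) ≤ n := by exact_mod_cast hn
  have h := Real.log_le_sub_one_of_pos (show (0 : ℝ) < (n : ℝ) / (n + 1) by positivity)
  have hinv : Real.log ((n : ℝ) / (n + 1)) = -Real.log (((n : ℝ) + 1) / n) := by
    rw [← Real.log_inv, inv_div]
  have h2 : (n : ℝ) / (n + 1) - 1 = -(1 / (n + 1)) := by field_simp; ring
  rw [hinv, h2] at h
  have h3 : (1 : ℝ) / (n + 1) ≤ Real.log (((n : ℝ) + 1) / n) := by linarith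
  have h4 : (1 : ℝ) / n ≤ 2 * (1 / (n + 1)) := by
    rw [div_le_iff₀ hn0]
    rw [show 2 * (1 / ((n : ℝ) + 1)) * n = 2 * n / (n + 1) by ring, le_div_iff₀ (by positivity)]
    linarith
  linarith

/-- Telescoping: `Σ_{N₁ ≤ n < N₂} (1/n − 1/(n+1)) = 1/N₁ − 1/N₂` (`N₁ ≥ 1`). [folklore] -/
private theorem sum_inv_sub_inv_succ {N₁ N₂ : ℕ} (h : N₁ ≤ N₂) :
    ∑ n ∈ Finset.Ico N₁ N₂, ((1 : ℝ) / n - 1 / (n + 1)) = 1 / N₁ - 1 / N₂ := by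
  induction N₂, h using Nat.le_induction with
  | base => simp
  | succ N hN ih =>
    rw [Finset.sum_Ico_succ_top hN, ih]
    push_cast
    ring

/-- `Σ_{N₁ ≤ n < N₂} log((n+1)/n) = log(N₂/N₁)` (`1 ≤ N₁ ≤ N₂`). [folklore] -/
private theorem sum_log_succ_div {N₁ N₂ : ℕ} (h1 : 1 ≤ N₁) (h : N₁ ≤ N₂) :
    ∑ n ∈ Finset.Ico N₁ N₂, Real.log (((n : ℝ) + 1) / n) = Real.log ((N₂ : ℝ) / N₁) := by
  induction N₂, h using Nat.le_induction with
  | base =>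
    have : (N₁ : ℝ) ≠ 0 := by exact_mod_cast (by omega : N₁ ≠ 0)
    simp [div_self this]
  | succ N hN ih =>
    have hN0 : (0 : ℝ) < N := by exact_mod_cast (lt_of_lt_of_le (by omega : 0 < N₁) hN)
    have hN1 : (0 : ℝ) < N₁ := by exact_mod_cast (by omega : 0 < N₁)
    rw [Finset.sum_Ico_succ_top hN, ih, ← Real.log_mul (by positivity) (by positivity)]
    push_cast
    congr 1
    field_simp

/-- **Abel step of the §8/§10 evaluation rule.** If the weights `w(n) ≥ 0` have counting function
`A(N) = Σ_{1≤n<N} w(n)` with `|A(N) − c log N| ≤ K` for `1 ≤ N ≤ N₂`, and `F : ℕ → ℂ` satisfies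
`‖F(n)‖ ≤ M` on `[N₁, N₂]` and `‖F(n+1) − F(n)‖ ≤ L/n` on `[N₁, N₂)`, then
`‖Σ_{N₁≤n<N₂} w(n)F(n) − c·Σ_{N₁≤n<N₂} log((n+1)/n)F(n)‖ ≤ K(2M + 2L log(N₂/N₁))`.
[cite: Zhang2022LandauSiegel, §8 (8.11) p. 48] -/
theorem norm_sum_weight_sub_log_sum_le {w : ℕ → ℝ} {c K M L : ℝ} {F : ℕ → ℂ} {N₁ N₂ : ℕ}
    (h1 : 1 ≤ N₁) (h12 : N₁ ≤ N₂) (hK : 0 ≤ K) (hL : 0 ≤ L)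
    (hA : ∀ N : ℕ, 1 ≤ N → N ≤ N₂ →
      |(∑ n ∈ Finset.Ico 1 N, w n) - c * Real.log N| ≤ K)
    (hM : ∀ n : ℕ, N₁ ≤ n → n ≤ N₂ → ‖F n‖ ≤ M)
    (hLip : ∀ n : ℕ, N₁ ≤ n → n < N₂ → ‖F n - F (n + 1)‖ ≤ L / n) :
    ‖(∑ n ∈ Finset.Ico N₁ N₂, (w n : ℂ) * F n) -
        c * ∑ n ∈ Finset.Ico N₁ N₂, (Real.log (((n : ℝ) + 1) / n) : ℂ) * F n‖ ≤
      K * (2 * M + 2 * L * Real.log ((N₂ : ℝ) / N₁)) := by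
  -- the counting function and its deviation from `c log`
  set A : ℕ → ℂ := fun N => ((∑ n ∈ Finset.Ico 1 N, w n : ℝ) : ℂ) with hAdef
  set E : ℕ → ℂ := fun N => A N - c * (Real.log N : ℂ) with hEdef
  have hw : ∀ n, N₁ ≤ n → (w n : ℂ) = A (n + 1) - A n := by
    intro n hn
    simp only [hAdef]
    rw [Finset.sum_Ico_succ_top (by omega : 1 ≤ n)]
    push_cast; ring
  have hlog : ∀ n, N₁ ≤ n → (Real.log (((n : ℝ) + 1) / n) : ℂ) =
      (Real.log ((n + 1 : ℕ) : ℝ) : ℂ) - (Real.log (n : ℝ) : ℂ) := by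
    intro n hn
    have hn0 : (0 : ℝ) < n := by exact_mod_cast (lt_of_lt_of_le (by omega : 0 < N₁) hn)
    rw [← Complex.ofReal_sub, ← Real.log_div (by positivity) hn0.ne']
    push_cast; ring_nf
  have hE : ∀ N, 1 ≤ N → N ≤ N₂ → ‖E N‖ ≤ K := by
    intro N hN hN2
    simp only [hEdef, hAdef]
    rw [← Complex.ofReal_mul, ← Complex.ofReal_sub, Complex.norm_real, Real.norm_eq_abs]
    exact hA N hN hN2
  -- rewrite both sums by parts
  have eq1 : ∑ n ∈ Finset.Ico N₁ N₂, (w n : ℂ) * F n =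
      ∑ n ∈ Finset.Ico N₁ N₂, (A (n + 1) - A n) * F n :=
    Finset.sum_congr rfl fun n hn => by rw [hw n (Finset.mem_Ico.mp hn).1]
  have eq2 : c * ∑ n ∈ Finset.Ico N₁ N₂, (Real.log (((n : ℝ) + 1) / n) : ℂ) * F n =
      ∑ n ∈ Finset.Ico N₁ N₂,
        ((c : ℂ) * (Real.log ((n + 1 : ℕ) : ℝ) : ℂ) - c * (Real.log (n : ℝ) : ℂ)) * F n := by
    rw [Finset.mul_sum]
    refine Finset.sum_congr rfl fun n hn => ?_
    rw [hlog n (Finset.mem_Ico.mp hn).1]; ring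
  rw [eq1, eq2, sbp h12, sbp (A := fun N => (c : ℂ) * (Real.log (N : ℝ) : ℂ)) h12]
  have key : A N₂ * F N₂ - A N₁ * F N₁ +
        ∑ n ∈ Finset.Ico N₁ N₂, A (n + 1) * (F n - F (n + 1)) -
      ((c : ℂ) * (Real.log (N₂ : ℝ) : ℂ) * F N₂ - c * (Real.log (N₁ : ℝ) : ℂ) * F N₁ +
        ∑ n ∈ Finset.Ico N₁ N₂, c * (Real.log ((n + 1 : ℕ) : ℝ) : ℂ) * (F n - F (n + 1))) =
      E N₂ * F N₂ - E N₁ * F N₁ + ∑ n ∈ Finset.Ico N₁ N₂, E (n + 1) * (F n - F (n + 1)) := by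
    have hs : ∑ n ∈ Finset.Ico N₁ N₂, E (n + 1) * (F n - F (n + 1)) =
        ∑ n ∈ Finset.Ico N₁ N₂, A (n + 1) * (F n - F (n + 1)) -
          ∑ n ∈ Finset.Ico N₁ N₂, c * (Real.log ((n + 1 : ℕ) : ℝ) : ℂ) * (F n - F (n + 1)) := by
      rw [← Finset.sum_sub_distrib]
      refine Finset.sum_congr rfl fun n _ => ?_
      simp only [hEdef]
      push_cast
      ring
    rw [hs]
    simp only [hEdef]
    ring
  rw [key]
  have hN2 : ‖E N₂ * F N₂‖ ≤ K * M := by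
    rw [norm_mul]; exact mul_le_mul (hE N₂ (h1.trans h12) le_rfl) (hM N₂ h12 le_rfl)
      (norm_nonneg _) hK
  have hN1 : ‖E N₁ * F N₁‖ ≤ K * M := by
    rw [norm_mul]; exact mul_le_mul (hE N₁ h1 h12) (hM N₁ le_rfl h12) (norm_nonneg _) hK
  have hS : ‖∑ n ∈ Finset.Ico N₁ N₂, E (n + 1) * (F n - F (n + 1))‖ ≤
      K * (2 * L * Real.log ((N₂ : ℝ) / N₁)) := by
    refine (norm_sum_le _ _).trans ?_
    calc ∑ n ∈ Finset.Ico N₁ N₂, ‖E (n + 1) * (F n - F (n + 1))‖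
        ≤ ∑ n ∈ Finset.Ico N₁ N₂, K * (L * (2 * Real.log (((n : ℝ) + 1) / n))) := by
          refine Finset.sum_le_sum fun n hn => ?_
          obtain ⟨hn1, hn2⟩ := Finset.mem_Ico.mp hn
          rw [norm_mul]
          refine mul_le_mul (hE (n + 1) (by omega) (by omega)) ((hLip n hn1 hn2).trans ?_)
            (norm_nonneg _) hK
          rw [div_eq_mul_one_div]
          exact mul_le_mul_of_nonneg_left (inv_le_two_log_succ_div (le_trans h1 hn1)) hL
      _ = K * (2 * L * Real.log ((N₂ : ℝ) / N₁)) := by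
          rw [← Finset.mul_sum, ← Finset.mul_sum, ← Finset.mul_sum, sum_log_succ_div h1 h12]
          ring
  calc ‖E N₂ * F N₂ - E N₁ * F N₁ + ∑ n ∈ Finset.Ico N₁ N₂, E (n + 1) * (F n - F (n + 1))‖
      ≤ ‖E N₂ * F N₂‖ + ‖E N₁ * F N₁‖ +
          ‖∑ n ∈ Finset.Ico N₁ N₂, E (n + 1) * (F n - F (n + 1))‖ := by
        refine (norm_add_le _ _).trans ?_
        gcongr
        exact norm_sub_le _ _
    _ ≤ K * M + K * M + K * (2 * L * Real.log ((N₂ : ℝ) / N₁)) := by gcongr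
    _ = K * (2 * M + 2 * L * Real.log ((N₂ : ℝ) / N₁)) := by ring

/-- `∫ₐᵇ dt/t = log(b/a)` for the complex-valued integrand `(t : ℂ)⁻¹`. [folklore] -/
private theorem integral_ofReal_inv {a b : ℝ} (ha : 0 < a) (hb : 0 < b) :
    ∫ t in a..b, ((t : ℝ) : ℂ)⁻¹ = (Real.log (b / a) : ℂ) := by
  simp_rw [← Complex.ofReal_inv]
  rw [intervalIntegral.integral_ofReal, integral_inv_of_pos ha hb]

/-- **Riemann step**: for `F : ℝ → ℂ` continuous on `[N₁, N₂]` (`N₁ ≥ 1`) with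
`‖F(x) − F(y)‖ ≤ L(y − x)/x` for `N₁ ≤ x ≤ y ≤ N₂`,
`‖Σ_{N₁≤n<N₂} log((n+1)/n)F(n) − ∫_{N₁}^{N₂} F(t)dt/t‖ ≤ 2L/N₁`.
[cite: Zhang2022LandauSiegel, §8 (8.11) p. 48] -/
theorem norm_log_sum_sub_integral_le {F : ℝ → ℂ} {L : ℝ} {N₁ N₂ : ℕ} (h1 : 1 ≤ N₁) (h12 : N₁ ≤ N₂)
    (hL : 0 ≤ L) (hFc : ContinuousOn F (Set.Icc (N₁ : ℝ) N₂))
    (hLip : ∀ x y : ℝ, (N₁ : ℝ) ≤ x → x ≤ y → y ≤ N₂ → ‖F x - F y‖ ≤ L * (y - x) / x) :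
    ‖(∑ n ∈ Finset.Ico N₁ N₂, (Real.log (((n : ℝ) + 1) / n) : ℂ) * F n) -
        ∫ t in (N₁ : ℝ)..N₂, F t / t‖ ≤ 2 * L / N₁ := by
  have hN1 : (0 : ℝ) < N₁ := by exact_mod_cast (by omega : 0 < N₁)
  -- integrability on the unit intervals
  have hintF : ∀ n : ℕ, N₁ ≤ n → n < N₂ →
      IntervalIntegrable (fun t : ℝ => F t / t) MeasureTheory.volume (n : ℝ) ((n : ℝ) + 1) := by
    intro n hn1 hn2
    have hn0 : (0 : ℝ) < n := by exact_mod_cast (lt_of_lt_of_le (by omega : 0 < N₁) hn1)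
    refine ContinuousOn.intervalIntegrable ?_
    rw [Set.uIcc_of_le (by linarith)]
    refine ContinuousOn.div (hFc.mono ?_) (Complex.continuous_ofReal.continuousOn) ?_
    · exact Set.Icc_subset_Icc (by exact_mod_cast hn1) (by exact_mod_cast (by omega : n + 1 ≤ N₂))
    · intro t ht
      exact_mod_cast ne_of_gt (lt_of_lt_of_le hn0 ht.1)
  have hintC : ∀ n : ℕ, N₁ ≤ n → ∀ z : ℂ,
      IntervalIntegrable (fun t : ℝ => z / t) MeasureTheory.volume (n : ℝ) ((n : ℝ) + 1) := by
    intro n hn1 z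
    have hn0 : (0 : ℝ) < n := by exact_mod_cast (lt_of_lt_of_le (by omega : 0 < N₁) hn1)
    refine ContinuousOn.intervalIntegrable ?_
    rw [Set.uIcc_of_le (by linarith)]
    refine ContinuousOn.div continuousOn_const (Complex.continuous_ofReal.continuousOn) ?_
    intro t ht
    exact_mod_cast ne_of_gt (lt_of_lt_of_le hn0 ht.1)
  -- split the integral at the integers
  have hsplit : ∫ t in (N₁ : ℝ)..N₂, F t / t =
      ∑ n ∈ Finset.Ico N₁ N₂, ∫ t in (n : ℝ)..((n : ℝ) + 1), F t / t := by
    have h := intervalIntegral.sum_integral_adjacent_intervals_Ico (a := fun n : ℕ => (n : ℝ))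
      (f := fun t : ℝ => F t / t) (μ := MeasureTheory.volume) h12
      (fun n hn => by
        have := hintF n hn.1 hn.2
        simpa [Nat.cast_succ] using this)
    simpa [Nat.cast_succ] using h.symm
  rw [hsplit, ← Finset.sum_sub_distrib]
  -- per unit interval
  have hper : ∀ n ∈ Finset.Ico N₁ N₂,
      ‖(Real.log (((n : ℝ) + 1) / n) : ℂ) * F n - ∫ t in (n : ℝ)..((n : ℝ) + 1), F t / t‖ ≤
        2 * L * (1 / n - 1 / (n + 1)) := by
    intro n hn
    obtain ⟨hn1, hn2⟩ := Finset.mem_Ico.mp hn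
    have hn0 : (0 : ℝ) < n := by exact_mod_cast (lt_of_lt_of_le (by omega : 0 < N₁) hn1)
    have hn1' : (1 : ℝ) ≤ n := by exact_mod_cast (le_trans h1 hn1)
    have hconst : (Real.log (((n : ℝ) + 1) / n) : ℂ) * F n =
        ∫ t in (n : ℝ)..((n : ℝ) + 1), F n / t := by
      have : (fun t : ℝ => F n / (t : ℂ)) = fun t : ℝ => F n * ((t : ℝ) : ℂ)⁻¹ := by
        funext t; rw [div_eq_mul_inv]
      rw [this, intervalIntegral.integral_const_mul, integral_ofReal_inv hn0 (by linarith), mul_comm]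
    rw [hconst, ← intervalIntegral.integral_sub (hintC n hn1 (F n)) (hintF n hn1 hn2)]
    have hb : ∀ t ∈ Set.uIoc (n : ℝ) ((n : ℝ) + 1), ‖F n / t - F t / t‖ ≤
        L * (1 / n) * (1 / n) := by
      intro t ht
      rw [Set.uIoc_of_le (by linarith), Set.mem_Ioc] at ht
      have ht0 : 0 < t := hn0.trans ht.1
      rw [← sub_div, norm_div, Complex.norm_real, Real.norm_of_nonneg ht0.le]
      have hFt : ‖F n - F t‖ ≤ L * (1 / n) := by
        refine (hLip n t (by exact_mod_cast hn1) ht.1.le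
          (le_trans ht.2 (by exact_mod_cast (by omega : n + 1 ≤ N₂)))).trans ?_
        rw [mul_one_div, div_le_div_iff_of_pos_right hn0]
        exact mul_le_of_le_one_right hL (by linarith)
      rw [div_le_iff₀ ht0]
      calc ‖F n - F t‖ ≤ L * (1 / n) := hFt
        _ = L * (1 / n) * (1 / n) * n := by field_simp
        _ ≤ L * (1 / n) * (1 / n) * t := by
            have : 0 ≤ L * (1 / (n : ℝ)) * (1 / n) := by positivity
            exact mul_le_mul_of_nonneg_left ht.1.le this
    refine (intervalIntegral.norm_integral_le_of_norm_le_const hb).trans ?_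
    rw [show |(n : ℝ) + 1 - n| = 1 by norm_num]
    have hsq : (1 : ℝ) / n * (1 / n) ≤ 2 * (1 / n - 1 / (n + 1)) := by
      rw [show 2 * (1 / (n : ℝ) - 1 / (n + 1)) = 2 / (n * (n + 1)) by field_simp; ring]
      rw [div_mul_div_comm, one_mul, div_le_div_iff₀ (by positivity) (by positivity)]
      nlinarith
    calc L * (1 / (n : ℝ)) * (1 / n) * 1 = L * (1 / n * (1 / n)) := by ring
      _ ≤ L * (2 * (1 / n - 1 / (n + 1))) := mul_le_mul_of_nonneg_left hsq hL
      _ = 2 * L * (1 / n - 1 / (n + 1)) := by ring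
  refine (norm_sum_le _ _).trans ?_
  calc ∑ n ∈ Finset.Ico N₁ N₂,
        ‖(Real.log (((n : ℝ) + 1) / n) : ℂ) * F n - ∫ t in (n : ℝ)..((n : ℝ) + 1), F t / t‖
      ≤ ∑ n ∈ Finset.Ico N₁ N₂, 2 * L * (1 / n - 1 / (n + 1)) := Finset.sum_le_sum hper
    _ = 2 * L * (1 / N₁ - 1 / N₂) := by rw [← Finset.mul_sum, sum_inv_sub_inv_succ h12]
    _ ≤ 2 * L / N₁ := by
        have : (0 : ℝ) ≤ 1 / N₂ := by positivity
        have h2L : 0 ≤ 2 * L := by positivity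
        calc 2 * L * (1 / (N₁ : ℝ) - 1 / N₂) ≤ 2 * L * (1 / N₁) := by
              exact mul_le_mul_of_nonneg_left (by linarith) h2L
          _ = 2 * L / N₁ := by ring

/-- **Endpoint step**: moving the integration limits from `(⌈lo⌉, ⌈hi⌉)` to `(lo, hi)` costs at most
`2M/lo` when `‖F‖ ≤ M` on `[lo, hi + 1]` (`1 ≤ lo ≤ hi`). [cite: Zhang2022LandauSiegel, §8 (8.11) p. 48] -/
theorem norm_integral_ceil_sub_integral_le {F : ℝ → ℂ} {M lo hi : ℝ} (hlo : 1 ≤ lo) (hlh : lo ≤ hi)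
    (hFc : ContinuousOn F (Set.Icc lo (hi + 1))) (hM : ∀ t, lo ≤ t → t ≤ hi + 1 → ‖F t‖ ≤ M) :
    ‖(∫ t in (⌈lo⌉₊ : ℝ)..⌈hi⌉₊, F t / t) - ∫ t in lo..hi, F t / t‖ ≤ 2 * M / lo := by
  have hlo0 : 0 < lo := by linarith
  have hM0 : 0 ≤ M := le_trans (norm_nonneg _) (hM lo le_rfl (by linarith))
  have hc1 : lo ≤ (⌈lo⌉₊ : ℝ) := Nat.le_ceil _
  have hc2 : (⌈lo⌉₊ : ℝ) < lo + 1 := Nat.ceil_lt_add_one hlo0.le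
  have hc3 : hi ≤ (⌈hi⌉₊ : ℝ) := Nat.le_ceil _
  have hc4 : (⌈hi⌉₊ : ℝ) < hi + 1 := Nat.ceil_lt_add_one (by linarith)
  have hint : ∀ a b : ℝ, lo ≤ a → a ≤ hi + 1 → lo ≤ b → b ≤ hi + 1 →
      IntervalIntegrable (fun t : ℝ => F t / t) MeasureTheory.volume a b := by
    intro a b ha ha' hb hb'
    refine ContinuousOn.intervalIntegrable ?_
    have hsub : Set.uIcc a b ⊆ Set.Icc lo (hi + 1) := Set.uIcc_subset_Icc ⟨ha, ha'⟩ ⟨hb, hb'⟩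
    refine ContinuousOn.div (hFc.mono hsub) (Complex.continuous_ofReal.continuousOn) fun t ht => ?_
    exact_mod_cast ne_of_gt (lt_of_lt_of_le hlo0 (hsub ht).1)
  have hbound : ∀ a b : ℝ, lo ≤ a → a ≤ b → b ≤ hi + 1 →
      ‖∫ t in a..b, F t / t‖ ≤ M / lo * (b - a) := by
    intro a b ha hab hb
    have h := intervalIntegral.norm_integral_le_of_norm_le_const (a := a) (b := b) (C := M / lo)
      (f := fun t : ℝ => F t / t) (fun t ht => by
        rw [Set.uIoc_of_le hab, Set.mem_Ioc] at ht
        have ht0 : lo ≤ t := le_trans ha ht.1.le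
        rw [norm_div, Complex.norm_real, Real.norm_of_nonneg (by linarith)]
        rw [div_le_div_iff₀ (by linarith) hlo0]
        calc ‖F t‖ * lo ≤ M * lo := by gcongr; exact hM t ht0 (le_trans ht.2 hb)
          _ ≤ M * t := by gcongr)
    rwa [abs_of_nonneg (by linarith)] at h
  have e1 : (∫ t in (⌈lo⌉₊ : ℝ)..⌈hi⌉₊, F t / t) - ∫ t in lo..hi, F t / t =
      (∫ t in hi..(⌈hi⌉₊ : ℝ), F t / t) - ∫ t in lo..(⌈lo⌉₊ : ℝ), F t / t := by
    have hl2 : (⌈lo⌉₊ : ℝ) ≤ hi + 1 := by linarith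
    rw [← intervalIntegral.integral_add_adjacent_intervals (hint lo ⌈lo⌉₊ le_rfl (by linarith) hc1 hl2)
      (hint ⌈lo⌉₊ hi hc1 hl2 hlh (by linarith)),
      ← intervalIntegral.integral_add_adjacent_intervals
        (hint (⌈lo⌉₊ : ℝ) hi hc1 hl2 hlh (by linarith)) (hint hi ⌈hi⌉₊ hlh (by linarith) (by linarith) hc4.le)]
    ring
  rw [e1]
  calc ‖(∫ t in hi..(⌈hi⌉₊ : ℝ), F t / t) - ∫ t in lo..(⌈lo⌉₊ : ℝ), F t / t‖
      ≤ ‖∫ t in hi..(⌈hi⌉₊ : ℝ), F t / t‖ + ‖∫ t in lo..(⌈lo⌉₊ : ℝ), F t / t‖ := norm_sub_le _ _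
    _ ≤ M / lo * ((⌈hi⌉₊ : ℝ) - hi) + M / lo * ((⌈lo⌉₊ : ℝ) - lo) := by
        gcongr
        · exact hbound hi _ hlh hc3 hc4.le
        · exact hbound lo _ le_rfl hc1 (by linarith)
    _ ≤ M / lo * 1 + M / lo * 1 := by
        have hMl : 0 ≤ M / lo := div_nonneg hM0 hlo0.le
        gcongr <;> linarith
    _ = 2 * M / lo := by ring

/-- **The §8/§10 evaluation rule (weights with a `c log`-counting function against a slowly varying
profile).** If `|Σ_{1≤n<N} w(n) − c log N| ≤ K` for `1 ≤ N ≤ ⌈hi⌉` and `F` is continuous on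
`[lo, hi + 1]` (`1 ≤ lo ≤ hi`) with `‖F‖ ≤ M` and `‖F(x) − F(y)‖ ≤ L(y − x)/x` there (e.g.
`‖F′(t)‖ ≤ L/t`), then
`‖Σ_{⌈lo⌉≤n<⌈hi⌉} w(n)F(n) − c∫_{lo}^{hi}F(t)dt/t‖ ≤ K(2M + 2L log((hi+1)/lo)) + |c|(2L + 2M)/lo`
(a ceiling-indexed, Lipschitz variant of the tree's `AbelLog.norm_sum_mul_sub_integral_le`)
— the partial summation behind (8.11) ("it follows by partial integration") and behind every
"`Σ_{P^a≤n<P^b}|χ(n)|λ₀ⱼ(n)φ(n)⁻¹g(n) = (𝔞/L′(1,χ)²)∫g(x)dx/x + …`" display of §10.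
[cite: Zhang2022LandauSiegel, §8 (8.11) p. 48] -/
theorem norm_sum_weight_sub_integral_le {w : ℕ → ℝ} {c K M L : ℝ} {F : ℝ → ℂ} {lo hi : ℝ}
    (hlo : 1 ≤ lo) (hlh : lo ≤ hi) (hK : 0 ≤ K) (hL : 0 ≤ L)
    (hA : ∀ N : ℕ, 1 ≤ N → N ≤ ⌈hi⌉₊ →
      |(∑ n ∈ Finset.Ico 1 N, w n) - c * Real.log N| ≤ K)
    (hFc : ContinuousOn F (Set.Icc lo (hi + 1)))
    (hM : ∀ t, lo ≤ t → t ≤ hi + 1 → ‖F t‖ ≤ M)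
    (hLip : ∀ x y : ℝ, lo ≤ x → x ≤ y → y ≤ hi + 1 → ‖F x - F y‖ ≤ L * (y - x) / x) :
    ‖(∑ n ∈ Finset.Ico ⌈lo⌉₊ ⌈hi⌉₊, (w n : ℂ) * F n) - c * ∫ t in lo..hi, F t / t‖ ≤
      K * (2 * M + 2 * L * Real.log ((hi + 1) / lo)) + |c| * (2 * L + 2 * M) / lo := by
  have hlo0 : 0 < lo := by linarith
  have hM0 : 0 ≤ M := le_trans (norm_nonneg _) (hM lo le_rfl (by linarith))
  have hc1 : lo ≤ (⌈lo⌉₊ : ℝ) := Nat.le_ceil _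
  have hc4 : (⌈hi⌉₊ : ℝ) < hi + 1 := Nat.ceil_lt_add_one (by linarith)
  have h1 : 1 ≤ ⌈lo⌉₊ := Nat.one_le_ceil_iff.mpr hlo0
  have h12 : ⌈lo⌉₊ ≤ ⌈hi⌉₊ := Nat.ceil_mono hlh
  have hN1 : (0 : ℝ) < (⌈lo⌉₊ : ℝ) := by exact_mod_cast (by omega : 0 < ⌈lo⌉₊)
  -- the three steps
  have s1 := norm_sum_weight_sub_log_sum_le (w := w) (c := c) (F := fun n : ℕ => F n) h1 h12 hK hL
    hA (fun n hn1 hn2 => hM n (le_trans hc1 (by exact_mod_cast hn1))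
      (le_trans (by exact_mod_cast hn2) hc4.le))
    (fun n hn1 hn2 => by
      have : ((n : ℝ) + 1) ≤ (⌈hi⌉₊ : ℝ) := by exact_mod_cast (by omega : n + 1 ≤ ⌈hi⌉₊)
      have h := hLip n ((n : ℝ) + 1) (le_trans hc1 (by exact_mod_cast hn1)) (by linarith) (by linarith)
      rw [show (n : ℝ) + 1 - n = 1 by ring, mul_one] at h
      simpa only [Nat.cast_succ] using h)
  have s2 := norm_log_sum_sub_integral_le (F := F) (L := L) h1 h12 hL
    (hFc.mono (Set.Icc_subset_Icc hc1 hc4.le))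
    (fun x y hx hxy hy => hLip x y (le_trans hc1 hx) hxy (le_trans hy hc4.le))
  have s3 := norm_integral_ceil_sub_integral_le hlo hlh hFc hM
  -- combine
  have key : (∑ n ∈ Finset.Ico ⌈lo⌉₊ ⌈hi⌉₊, (w n : ℂ) * F n) - c * ∫ t in lo..hi, F t / t =
      ((∑ n ∈ Finset.Ico ⌈lo⌉₊ ⌈hi⌉₊, (w n : ℂ) * F n) -
          c * ∑ n ∈ Finset.Ico ⌈lo⌉₊ ⌈hi⌉₊, (Real.log (((n : ℝ) + 1) / n) : ℂ) * F n) +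
        (c : ℂ) * ((∑ n ∈ Finset.Ico ⌈lo⌉₊ ⌈hi⌉₊, (Real.log (((n : ℝ) + 1) / n) : ℂ) * F n) -
          ∫ t in (⌈lo⌉₊ : ℝ)..⌈hi⌉₊, F t / t) +
        (c : ℂ) * ((∫ t in (⌈lo⌉₊ : ℝ)..⌈hi⌉₊, F t / t) - ∫ t in lo..hi, F t / t) := by ring
  rw [key]
  have hc : ‖(c : ℂ)‖ = |c| := by rw [Complex.norm_real, Real.norm_eq_abs]
  have hN2 : (0 : ℝ) < (⌈hi⌉₊ : ℝ) := by exact_mod_cast (by omega : 0 < ⌈hi⌉₊)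
  have hlogle : Real.log ((⌈hi⌉₊ : ℝ) / ⌈lo⌉₊) ≤ Real.log ((hi + 1) / lo) := by
    apply Real.log_le_log (div_pos hN2 hN1)
    rw [div_le_div_iff₀ hN1 hlo0]
    nlinarith
  calc ‖((∑ n ∈ Finset.Ico ⌈lo⌉₊ ⌈hi⌉₊, (w n : ℂ) * F n) -
            c * ∑ n ∈ Finset.Ico ⌈lo⌉₊ ⌈hi⌉₊, (Real.log (((n : ℝ) + 1) / n) : ℂ) * F n) +
          (c : ℂ) * ((∑ n ∈ Finset.Ico ⌈lo⌉₊ ⌈hi⌉₊, (Real.log (((n : ℝ) + 1) / n) : ℂ) * F n) -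
            ∫ t in (⌈lo⌉₊ : ℝ)..⌈hi⌉₊, F t / t) +
          (c : ℂ) * ((∫ t in (⌈lo⌉₊ : ℝ)..⌈hi⌉₊, F t / t) - ∫ t in lo..hi, F t / t)‖
      ≤ K * (2 * M + 2 * L * Real.log ((⌈hi⌉₊ : ℝ) / ⌈lo⌉₊)) + |c| * (2 * L / ⌈lo⌉₊) +
          |c| * (2 * M / lo) := by
        refine (norm_add_le _ _).trans ?_
        refine add_le_add ((norm_add_le _ _).trans (add_le_add s1 ?_)) ?_
        · rw [norm_mul, hc]; exact mul_le_mul_of_nonneg_left s2 (abs_nonneg c)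
        · rw [norm_mul, hc]; exact mul_le_mul_of_nonneg_left s3 (abs_nonneg c)
    _ ≤ K * (2 * M + 2 * L * Real.log ((hi + 1) / lo)) + |c| * (2 * L / lo) + |c| * (2 * M / lo) := by
        gcongr
    _ = K * (2 * M + 2 * L * Real.log ((hi + 1) / lo)) + |c| * (2 * L + 2 * M) / lo := by ring

end Engine

end Literature.NumberTheory.LFunctions.Zhang2022.SumIntegralRule
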